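import Summits.QuantumFields.YangMills.Theorems.UnitScaleTiltProp8HalvingSiteAssembly
import Summits.QuantumFields.YangMills.Theorems.UnitScaleTiltProp8FlatSmallSolution158CubeSeq
import Summits.QuantumFields.YangMills.Theorems.UnitScaleTiltProp8FlatCriticalEquation143
import HarnessLib

/-!
# Route `UnitScaleTilt`, crux K1 child «MinimiserStabilityRegPr» (stmt-QuantumFields-19200), registered stub V2′ `stub_halvingStep`
# (skeletons v8 5b4e846794b80374 / v10 `BirthV10`, OWNER RULING g24-№5) — **THE (165)-`A₁` ROW OF THE HALVING PACKAGE**: the three letters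
# `|A₁|`, `|∇^ηA₁|`, `|∂^{η*}∂^ηA₁|` of the small solution `A₁` of [Balaban1985Variational] (158) `A₁ + G̃((δ/δA′)V)(A₁ + HB) = 0` on the layer of
# the one-point top family at a site `x` — EXACTLY the (165)-`A₁` clause of `HalvingAssembly.H_of_package` / `HalvingAssemblyInterior.H_of_packageInt`
# (w3 g2, p595996 / interior package) — FROM pillar F4 (`FlatSmallSolution158CubeSeq.letter_solution158_dom_le`: the sup and gradient letters, BY NAME),
# Proposition 4's (98) for `W = (δ/δA′)V` (pillar P3b, `FlatProp4Bg1.exists_gradient_prop4_bg1_T3` for the pure-action part), and — for the second-order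
# letter, which print does NOT take from a sup-letter of `G̃` (VET ITEM 12 / LIT F9: *«no ℓ^∞ → ℓ^∞ letter with two derivatives around G, G̃ except the
# Laplacian»*) — THE `Δ_a`-ROW OF THE EQUATION ITSELF: `Δ_aA₁ = −(1 − Q*K⁻¹QG)w` (p. 298: *«P₀A₀ = A₀, Δ_aA₀ = (Δ + DRD*)A₀»*, (131)–(133) at background 1)

Cell `ym3-torus` (HUMAN RULING D-0037, YM ladder rung R3 — continuum SU(2) YM₃ on the torus is a RUNG, not the Clay problem), width seat
`ym-ust-19200-w5` gen 2 (WIDTH-5 ATTACH; OWNER g25 APPROVAL 02:19:01Z).  `--supports stmt-QuantumFields-19200 --as helper`; def-free, 0 sorry, standard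
axioms.  Bookkeeping over F4's theorems: NOTHING of Bałaban's analysis (the letters of `G̃`, `H`, `(QGQ*)⁻¹`, Prop. 4's constants, the identification of
Sect. F's `𝔊` with the Wilson action through the chart (47)) is proved here.

THE PRINT ([Balaban1985Variational] = T. Bałaban, CMP **102** (1985) 277–309; journal page = PDF page + 276).  p. 302 (158): *«The image of U′_k is a
minimum of 𝔊(A′), thus representing it as A₁ + HB, we obtain Eq. (143) for A₁. In the considered case it can be written as A₁ + G̃((δ/δA′)V)(A₁ + HB)
= 0. (158) The configurations HB and A₁ satisfy (152) with the bounds 4dL²B₁Mε₀ and 40dL²B₁Mε₀ correspondingly.»*; p. 304 (165): *«This bound,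
the equality (159) and Eq. (158) imply |A|, |∇^ηA|, |∂^{η*}∂^ηA|, |Δ^ηA| < ¼M_Δmax{B₃ε₁, ½ε₀} + B₀C₄(36dL²B₁Mε₀)² + B₀4C₂(36dL²B₁Mε₀)²»*; p. 298
(131)–(133): *«P₀ = I − GQ*(QGQ*)⁻¹Q. (131) … By the definition of H₀B we have QA₀ = 0, hence P₀A₀ = A₀, Δ_aA₀ = (Δ + DRD*)A₀ … we get (133)»*,
p. 297: *«The configuration A′₁ satisfies RD*A′₁ = 0, hence the above equation can be written … where Δ_a = Δ + DRD* + Q*aQ»*; p. 300: *«GP₀* = G −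
GQ*(QGQ*)⁻¹QG = G̃»*.

WHAT THIS FILE PROVES (no definition, no sorry):
* §1 (real matrix letters on finite index types, the currency of F4 `FlatCriticalEquation143` / w3's `FlatCriticalOfMin.eq143_of_isMinOn_affineBall`)
  **`Δa_mulVec_solution`** — for `G = Δ_a⁻¹`, `G̃ = G − GQᵀK⁻¹QG` and ANY solution `A₀ = −G̃w`: `Δ_aA₀ = −w + QᵀK⁻¹QGw` (= `−P₀ᵀw`, by
  `FlatCriticalEquation143.Δa_mul_Gt`); **`Δ_mulVec_solution`** — if `Δ_a = Δ + N + a·QᵀQ` (print: `N = ∂R∂*`) and `NA₀ = 0` (the gauge slice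
  `R∂*A₀ = 0`, (153)/(157)), then `ΔA₀ = −w + QᵀK⁻¹QGw` (`QA₀ = 0` is automatic, `Q_mul_Gt`); **`secondOrder_letter_le`** — hence
  `|ΔA₀(i)| ≤ (1 + q*·k·q·B₀)·ω` from the sup letters of `Qᵀ`, `K⁻¹ = (QGQᵀ)⁻¹` ([Balaban1984PropagatorsII] (2.46)), `Q`, `G` and `|w| ≤ ω`
  (`ω = C₄‖A₁ + HB‖²₍₁₁₅₎` by (98)).  THIS is where (165)'s `|∂^{η*}∂^ηA₁|` comes from; no second-order letter of `G̃` is used or stated.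
* §2 (F4's pointwise level-weighted currency at the d = 3 carrier, every member `F`, heights `n, K`, weights `w`, fibre `V`)
  **`supGrad_solution158_dom_le`** — the sup and `L^{K−n}`-gradient letters of every solution of (158) with weighted size `‖A₁ + 𝔄‖ ≤ r < a₃` are
  `≤ B₀C₄r²` at EVERY bond (F4 `letter_solution158_dom_le` twice); **`second_solution158_dom_le`** — any reading `T A₁` satisfying the `Δ`-row identity
  `T A₁ = −W(A₁ + 𝔄) + M(W(A₁ + 𝔄))` on a set, with `M` of weighted sup letter `B_M` (§1: `M = QᵀK⁻¹QG`), is `≤ (1 + B_M)C₄r²` there.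
* §3 **`row165_of_smallSolution`** — AT THE CUBE SEQUENCE `cubeSeqMT3 F n K x ρ S M` CENTRED AT `x` WITH ITS LEVEL WEIGHTS (`IsLevWeight`, `ρ ≥ 1`): the
  three conjuncts of the (165)-`A₁` clause of `H_of_package(Int)` VERBATIM (their `SideTouches`/`BondTouches` layer of the one-point top family at `x`, the
  letters `‖A₁⟨0+z, τ⟩‖`, `‖(L^{−(K−n)})⁻¹•(A₁⟨0+z+e_κ, τ⟩ − A₁⟨0+z, τ⟩)‖`, `‖pdiv (plaqCovDeriv (pull A₁ 0)) μ z‖` at background `1`) with any bound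
  `e ≥ max{B₀, 1 + B_M}·C₄r²` — from §2 and «the layer lies in the top cube, where the weights are 1» (`HalvingSiteAssembly.dist_le_one_of_sideTouches/
  _of_bondTouches`, `HalvingQuarterCubeSeq.inOm_top_of_dist`, `levWeight_eq_one_of_inOm_top`).  The consumer sets `e := K₁ε₀²` with `r = c·ε₀` ((152)).
HONEST SCOPE: hypotheses = F4's (`G̃` with the two weighted sup letters — P2's `GtSupLetterG` through `FlatScalarExtension`; `W` with (98) on the weighted
ball — P3b + the chart-dressing terms (84)–(89); the solution `A₁` and the size of `A₁ + HB` — (152)/(158), P1 + the E–L junction) plus the displayed `Δ`-row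
identity of §2/§3 (`hEL`), whose matrix form is §1 and whose instantiation (the flat `∂^{η*}∂^η` stencil as `Δ`, `N = ∂R∂*` vanishing on the slice, the sup
bound of `(QGQ*)⁻¹`) is the P5 assembler's.  NOT a claim about the stub, the crux, the rung, or the mass gap.

References: T. Bałaban, CMP **102** (1985) 277–309 [Balaban1985Variational] (131)–(133) p.298, (143) p.300, (152) p.301, (157)–(159) pp.302–303, (165) p.304;
CMP **96** (1984) 223–250 [Balaban1984PropagatorsII] (2.19) p.226, (2.46) p.231; CMP **99** (1985) 75–102 [Balaban1985RegularSpaces] (1.140) p.100.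
-/

set_option autoImplicit false

noncomputable section

open scoped BigOperators Matrix Matrix.Norms.L2Operator

namespace Summit.QuantumFields.YangMills.Theorems.HalvingA1Row165

open Literature.MathematicalPhysics.QuantumFieldTheory.Balaban1983to89
open B5Eq117TorusCarriers (Mk)
open B5Eq118OneStroke (iterBlockOf)
open B5Prop12FieldsLattice (distSite)
open B8Ineq132 (BondTouches)
open B8Eq140Level (SideTouches)
open B8Eq143PlaqExpansion (pdiv)
open B8Eq146AExpansion (plaqCovDeriv)
open B8Thm2SetupTorus (pullDom)
open B10Eq27TorusAxialLog (pull transl)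
open T3ContinuumYM3Torus (T3Family)
open FlatCubeOpsText (IsLevWeight)
open FlatCubeSequenceAligned (cubeSeqMT3)
open FlatCriticalEquation143 (Q_mul_Gt Δa_mul_Gt)
open FlatSmallSolution158CubeSeq (letter_solution158_dom_le)
open HalvingQuarterCubeSeq (levWeight_eq_one_of_inOm_top inOm_top_of_dist)
open HalvingSiteAssembly (dist_le_one_of_sideTouches dist_le_one_of_bondTouches distSite_iterBlockOf_le_one_of_le_one)

/-! ## §1 Matrix letters: the `Δ_a`-row and the `Δ`-row of the (143)/(158)-solution, from the equation itself -/

section MatrixLetters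

variable {ι κ : Type*} [Fintype ι] [Fintype κ] [DecidableEq ι] [DecidableEq κ]

/-- **`Δ_aA₀ = −w + QᵀK⁻¹QGw` FOR EVERY SOLUTION `A₀ = −G̃w` OF (143)/(158)** (`G = Δ_a⁻¹`, `G̃ = G − GQᵀK⁻¹QG = GP₀ᵀ`; `Δ_aG̃ = 1 − QᵀK⁻¹QG = P₀ᵀ`):
the second-order information of the solution is read off the EQUATION, not off a letter of `G̃` — p. 298: *«P₀A₀ = A₀, Δ_aA₀ = (Δ + DRD*)A₀ … (133)»*.
[cite: Balaban1985Variational, (131)-(133) p.298, (143) p.300, (158) p.302] -/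
theorem Δa_mulVec_solution (Δa G Gt : Matrix ι ι ℝ) (Q : Matrix κ ι ℝ) (K : Matrix κ κ ℝ)
    (hΔu : IsUnit Δa.det) (hG : G = Δa⁻¹) (hGt : Gt = G - G * Qᵀ * K⁻¹ * Q * G)
    {A₀ w : ι → ℝ} (hsol : A₀ = -(Gt *ᵥ w)) :
    Δa *ᵥ A₀ = -w + Qᵀ *ᵥ (K⁻¹ *ᵥ (Q *ᵥ (G *ᵥ w))) := by
  rw [hsol, Matrix.mulVec_neg, Matrix.mulVec_mulVec, Δa_mul_Gt Δa Q G K Gt hΔu hG hGt, Matrix.sub_mulVec, Matrix.one_mulVec,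
    neg_sub, Matrix.mulVec_mulVec, Matrix.mulVec_mulVec, Matrix.mulVec_mulVec]
  abel

/-- **`ΔA₀ = −w + QᵀK⁻¹QGw` ON THE GAUGE SLICE**: if `Δ_a = Δ + N + a·QᵀQ` (print: `Δ_a = ∂*∂ + ∂R∂* + Q*aQ`, [Balaban1984PropagatorsII] (2.19);
`N = ∂R∂*`) and `NA₀ = 0` (the slice `R∂*A₀ = 0` of (153)/(157), on which print works: *«The configuration A′₁ satisfies RD*A′₁ = 0, hence the above
equation can be written as … Δ_a»*, p. 297), then — `QA₀ = 0` being automatic (`QG̃ = 0`) — the flat second-order operator `Δ` of the solution equals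
`−w + QᵀK⁻¹QGw`.  [cite: Balaban1985Variational, (128) p.297, (131)-(133) p.298, (157)-(158) p.302; Balaban1984PropagatorsII, (2.19) p.226] -/
theorem Δ_mulVec_solution (Δa G Gt Δ N : Matrix ι ι ℝ) (Q : Matrix κ ι ℝ) (K : Matrix κ κ ℝ) (a : ℝ)
    (hΔu : IsUnit Δa.det) (hG : G = Δa⁻¹) (hK : K = Q * G * Qᵀ) (hKu : IsUnit K.det) (hGt : Gt = G - G * Qᵀ * K⁻¹ * Q * G)
    (hsplit : Δa = Δ + N + a • (Qᵀ * Q)) {A₀ w : ι → ℝ} (hsol : A₀ = -(Gt *ᵥ w)) (hN : N *ᵥ A₀ = 0) :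
    Δ *ᵥ A₀ = -w + Qᵀ *ᵥ (K⁻¹ *ᵥ (Q *ᵥ (G *ᵥ w))) := by
  have hQA₀ : Q *ᵥ A₀ = 0 := by
    rw [hsol, Matrix.mulVec_neg, Matrix.mulVec_mulVec, Q_mul_Gt Q G K Gt hK hKu hGt, Matrix.zero_mulVec, neg_zero]
  have h := Δa_mulVec_solution Δa G Gt Q K hΔu hG hGt hsol
  rw [hsplit, Matrix.add_mulVec, Matrix.add_mulVec, Matrix.smul_mulVec, ← Matrix.mulVec_mulVec, hQA₀, Matrix.mulVec_zero, smul_zero,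
    add_zero, hN, add_zero] at h
  exact h

omit [DecidableEq ι] [DecidableEq κ] in
/-- **THE SECOND-ORDER LETTER OF THE SOLUTION, `|ΔA₀(i)| ≤ (1 + q*·k·q·B₀)·ω`** — from the `Δ`-row `ΔA₀ = −w + QᵀK⁻¹QGw` and the SUP letters of
`Qᵀ` (`q*`), `K⁻¹ = (QGQᵀ)⁻¹` (`k`, [Balaban1984PropagatorsII] (2.46)), `Q` (`q`), `G` (`B₀`) and `|w(i)| ≤ ω` (`ω = C₄‖A₁ + HB‖²₍₁₁₅₎` by (98)):
the *«B₀C₄(36dL²B₁Mε₀)²»* entry of (165) for `|∂^{η*}∂^ηA|`.  No two-derivative letter of `G̃` is used. [cite: Balaban1985Variational, (165) p.304, (133) p.298;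
Balaban1984PropagatorsII, (2.46) p.231] -/
theorem secondOrder_letter_le (Δ G : Matrix ι ι ℝ) (Q : Matrix κ ι ℝ) (Kinv : Matrix κ κ ℝ) {A₀ w : ι → ℝ} {qs k q B₀ ω : ℝ}
    (hΔ : Δ *ᵥ A₀ = -w + Qᵀ *ᵥ (Kinv *ᵥ (Q *ᵥ (G *ᵥ w))))
    (hQs : ∀ (y : κ → ℝ) (β : ℝ), (∀ j, |y j| ≤ β) → ∀ i, |(Qᵀ *ᵥ y) i| ≤ qs * β)
    (hKi : ∀ (y : κ → ℝ) (β : ℝ), (∀ j, |y j| ≤ β) → ∀ j, |(Kinv *ᵥ y) j| ≤ k * β)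
    (hQ : ∀ (v : ι → ℝ) (β : ℝ), (∀ i, |v i| ≤ β) → ∀ j, |(Q *ᵥ v) j| ≤ q * β)
    (hGb : ∀ (v : ι → ℝ) (β : ℝ), (∀ i, |v i| ≤ β) → ∀ i, |(G *ᵥ v) i| ≤ B₀ * β)
    (hw : ∀ i, |w i| ≤ ω) (i : ι) :
    |(Δ *ᵥ A₀) i| ≤ (1 + qs * k * q * B₀) * ω := by
  have h1 : ∀ i, |(G *ᵥ w) i| ≤ B₀ * ω := hGb w ω hw
  have h2 : ∀ j, |(Q *ᵥ (G *ᵥ w)) j| ≤ q * (B₀ * ω) := hQ _ _ h1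
  have h3 : ∀ j, |(Kinv *ᵥ (Q *ᵥ (G *ᵥ w))) j| ≤ k * (q * (B₀ * ω)) := hKi _ _ h2
  have h4 : ∀ i, |(Qᵀ *ᵥ (Kinv *ᵥ (Q *ᵥ (G *ᵥ w)))) i| ≤ qs * (k * (q * (B₀ * ω))) := hQs _ _ h3
  rw [hΔ, Pi.add_apply, Pi.neg_apply]
  calc |-w i + (Qᵀ *ᵥ (Kinv *ᵥ (Q *ᵥ (G *ᵥ w)))) i| ≤ |-w i| + |(Qᵀ *ᵥ (Kinv *ᵥ (Q *ᵥ (G *ᵥ w)))) i| := abs_add_le _ _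
    _ ≤ ω + qs * (k * (q * (B₀ * ω))) := add_le_add (by rw [abs_neg]; exact hw i) (h4 i)
    _ = (1 + qs * k * q * B₀) * ω := by ring

end MatrixLetters

/-! ## §2 F4's level-weighted pointwise currency at the d = 3 carrier: the three letters of the (158)-solution at every bond -/

section Dom

variable {V : Type*} [NormedAddCommGroup V] [NormedSpace ℂ V]

/-- **THE SUP AND GRADIENT LETTERS OF EVERY SOLUTION OF (158), LEVEL-WEIGHTED, AT EVERY BOND** (F4 `letter_solution158_dom_le` read at the two letters
`N₁ f = w₁(b)‖f(b)‖`, `N₂ f = w₂(b)L^{K−n}‖f(b₋ + e_ν, μ(b)) − f(b)‖`): for `G̃` with the weighted sup → (sup, gradient) letters `B₀` (P2's `GtSupLetterG`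
through `FlatScalarExtension`), `W` with (98) on the weighted ball of radius `a₃`, and `A₁ + G̃(W(A₁ + 𝔄)) = 0` with weighted size `‖A₁ + 𝔄‖ ≤ r < a₃`:
`w₁(b)‖A₁(b)‖ ≤ B₀C₄r²` and `w₂(b)L^{K−n}‖A₁(b₋ + e_ν, μ(b)) − A₁(b)‖ ≤ B₀C₄r²` — the first two letters of (165)'s *«B₀C₄(36dL²B₁Mε₀)²»*.
[cite: Balaban1985Variational, (165) p.304, (158) p.302, (98) p.293] -/
theorem supGrad_solution158_dom_le (F : T3Family) (n K : ℕ) (w : ℕ → PBond (F.P K) 0 → ℝ)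
    (G : (PBond (F.P K) 0 → V) →ₗ[ℂ] (PBond (F.P K) 0 → V)) (W : (PBond (F.P K) 0 → V) → (PBond (F.P K) 0 → V))
    {B₀ C₄ a₃ r : ℝ}
    (hG : ∀ (f : PBond (F.P K) 0 → V) (β : ℝ), (∀ b, w 3 b * ‖f b‖ ≤ β) →
      (∀ b, w 1 b * ‖G f b‖ ≤ B₀ * β) ∧
        ∀ (b : PBond (F.P K) 0) (ν : Fin 3), w 2 b * (F.L : ℝ) ^ (K - n) * ‖G f ⟨b.src.shift ν, b.dir⟩ - G f b‖ ≤ B₀ * β)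
    (hWq : ∀ (Y : PBond (F.P K) 0 → V) (r' : ℝ), r' < a₃ → (∀ b, w 1 b * ‖Y b‖ ≤ r') →
      (∀ (b : PBond (F.P K) 0) (ν : Fin 3), w 2 b * (F.L : ℝ) ^ (K - n) * ‖Y ⟨b.src.shift ν, b.dir⟩ - Y b‖ ≤ r') →
        ∀ b, w 3 b * ‖W Y b‖ ≤ C₄ * r' ^ 2)
    {A₁ 𝔄 : PBond (F.P K) 0 → V} (hsol : A₁ + G (W (A₁ + 𝔄)) = 0) (hr : r < a₃)
    (h1 : ∀ b, w 1 b * ‖(A₁ + 𝔄) b‖ ≤ r)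
    (h2 : ∀ (b : PBond (F.P K) 0) (ν : Fin 3), w 2 b * (F.L : ℝ) ^ (K - n) * ‖(A₁ + 𝔄) ⟨b.src.shift ν, b.dir⟩ - (A₁ + 𝔄) b‖ ≤ r) :
    (∀ b, w 1 b * ‖A₁ b‖ ≤ B₀ * (C₄ * r ^ 2)) ∧
      ∀ (b : PBond (F.P K) 0) (ν : Fin 3), w 2 b * (F.L : ℝ) ^ (K - n) * ‖A₁ ⟨b.src.shift ν, b.dir⟩ - A₁ b‖ ≤ B₀ * (C₄ * r ^ 2) := by
  refine ⟨fun b => ?_, fun b ν => ?_⟩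
  · refine letter_solution158_dom_le F n K w G W hWq hsol hr h1 h2 (fun f => w 1 b * ‖f b‖) fun f β hf => ?_
    have h := (hG f β hf).1 b
    rwa [Pi.neg_apply, norm_neg]
  · refine letter_solution158_dom_le F n K w G W hWq hsol hr h1 h2
      (fun f => w 2 b * (F.L : ℝ) ^ (K - n) * ‖f ⟨b.src.shift ν, b.dir⟩ - f b‖) fun f β hf => ?_
    have h := (hG f β hf).2 b ν
    rwa [Pi.neg_apply, Pi.neg_apply, neg_sub_neg, norm_sub_rev]

omit [NormedSpace ℂ V] in
/-- **THE SECOND-ORDER LETTER OF THE SOLUTION FROM THE `Δ`-ROW OF THE EQUATION, LEVEL-WEIGHTED** (§1 in the pointwise currency): if a reading `T A₁` of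
the solution (the flat `∂^{η*}∂^ηA₁` at the points `y` of a set `S`, attached to bonds `π y`) satisfies the `Δ`-row identity `T A₁ y = −W(A₁ + 𝔄)(π y) +
(M(W(A₁ + 𝔄)))(π y)` on `S` (§1 `Δ_mulVec_solution`: `M = QᵀK⁻¹QG`), where `M` has the weighted sup letter `B_M` and `W` obeys (98) with `‖A₁ + 𝔄‖ ≤ r <
a₃`, then `w₃(π y)·‖T A₁ y‖ ≤ (1 + B_M)C₄r²` on `S`. [cite: Balaban1985Variational, (133) p.298, (165) p.304] -/
theorem second_solution158_dom_le [NormedSpace ℂ V] (F : T3Family) (n K : ℕ) (w : ℕ → PBond (F.P K) 0 → ℝ) (hw3 : ∀ b, 0 ≤ w 3 b)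
    (W : (PBond (F.P K) 0 → V) → (PBond (F.P K) 0 → V)) {C₄ a₃ r : ℝ}
    (hWq : ∀ (Y : PBond (F.P K) 0 → V) (r' : ℝ), r' < a₃ → (∀ b, w 1 b * ‖Y b‖ ≤ r') →
      (∀ (b : PBond (F.P K) 0) (ν : Fin 3), w 2 b * (F.L : ℝ) ^ (K - n) * ‖Y ⟨b.src.shift ν, b.dir⟩ - Y b‖ ≤ r') →
        ∀ b, w 3 b * ‖W Y b‖ ≤ C₄ * r' ^ 2)
    {A₁ 𝔄 : PBond (F.P K) 0 → V} (hr : r < a₃)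
    (h1 : ∀ b, w 1 b * ‖(A₁ + 𝔄) b‖ ≤ r)
    (h2 : ∀ (b : PBond (F.P K) 0) (ν : Fin 3), w 2 b * (F.L : ℝ) ^ (K - n) * ‖(A₁ + 𝔄) ⟨b.src.shift ν, b.dir⟩ - (A₁ + 𝔄) b‖ ≤ r)
    {Y : Type*} (T : (PBond (F.P K) 0 → V) → Y → V) (π : Y → PBond (F.P K) 0) (S : Set Y)
    (M : (PBond (F.P K) 0 → V) → (PBond (F.P K) 0 → V)) {B_M : ℝ}
    (hM : ∀ (f : PBond (F.P K) 0 → V) (β : ℝ), (∀ b, w 3 b * ‖f b‖ ≤ β) → ∀ b, w 3 b * ‖M f b‖ ≤ B_M * β)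
    (hEL : ∀ y ∈ S, T A₁ y = -(W (A₁ + 𝔄) (π y)) + M (W (A₁ + 𝔄)) (π y)) :
    ∀ y ∈ S, w 3 (π y) * ‖T A₁ y‖ ≤ (1 + B_M) * (C₄ * r ^ 2) := by
  have hWb : ∀ b, w 3 b * ‖W (A₁ + 𝔄) b‖ ≤ C₄ * r ^ 2 := hWq (A₁ + 𝔄) r hr h1 h2
  have hMb : ∀ b, w 3 b * ‖M (W (A₁ + 𝔄)) b‖ ≤ B_M * (C₄ * r ^ 2) := hM _ _ hWb
  intro y hy
  rw [hEL y hy]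
  calc w 3 (π y) * ‖-(W (A₁ + 𝔄) (π y)) + M (W (A₁ + 𝔄)) (π y)‖
      ≤ w 3 (π y) * (‖W (A₁ + 𝔄) (π y)‖ + ‖M (W (A₁ + 𝔄)) (π y)‖) :=
        mul_le_mul_of_nonneg_left ((norm_add_le _ _).trans (by rw [norm_neg])) (hw3 _)
    _ = w 3 (π y) * ‖W (A₁ + 𝔄) (π y)‖ + w 3 (π y) * ‖M (W (A₁ + 𝔄)) (π y)‖ := mul_add _ _ _
    _ ≤ C₄ * r ^ 2 + B_M * (C₄ * r ^ 2) := add_le_add (hWb _) (hMb _)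
    _ = (1 + B_M) * (C₄ * r ^ 2) := by ring

end Dom

/-! ## §3 The (165)-`A₁` clause of the halving package at the cube sequence centred at `x` -/

section Package

variable {F : T3Family} {n K : ℕ}

/-- **THE (165)-`A₁` ROW OF `HalvingAssembly.H_of_package` / `HalvingAssemblyInterior.H_of_packageInt`, VERBATIM, FROM F4 + (98) + THE `Δ`-ROW.**
At the cube sequence `D := cubeSeqMT3 F n K x ρ S M` (centre `x`, inner radius `ρ ≥ 1`) with its level weights `w` (`IsLevWeight`), let `G̃` carry P2's two
weighted sup letters (constant `B₀`), `W` Proposition 4's (98) on the weighted (115)-ball of radius `a₃` (constant `C₄`), and let `A₁` solve (158)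
`A₁ + G̃(W(A₁ + 𝔄)) = 0` with `‖A₁ + 𝔄‖₍₁₅₂₎ ≤ r < a₃` (print: `𝔄 = HB`, `r = 36dL²B₁Mε₀`); let the flat second-order letter of `A₁` on the `BondTouches`
layer of the one-point top family at `x` satisfy the `Δ`-row identity `∂^{η*}∂^ηA₁ = −W(A₁ + 𝔄) + M(W(A₁ + 𝔄))` (§1; `M = QᵀK⁻¹QG` with weighted sup letter
`B_M`).  Then for every `e ≥ B₀C₄r²`, `e ≥ (1 + B_M)C₄r²` the three conjuncts of the package's (165)-`A₁` clause hold with bound `e` (the consumer takes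
`e = K₁ε₀²`): the layer lies in the top cube `□_k ∋ Bᵏ(x)` (one block thick), where every weight is `1`.
[cite: Balaban1985Variational, (165) p.304, (158) p.302, (152) p.301, (133) p.298; Balaban1985RegularSpaces, (1.140) p.100] -/
theorem row165_of_smallSolution (hnK : n < K) (x : Site (F.P K) 0) (ρ S M : ℕ) (hM : 1 ≤ M) (hρ1 : 1 ≤ ρ)
    {w : ℕ → PBond (F.P K) 0 → ℝ} (hw : IsLevWeight F n K (cubeSeqMT3 F n K x ρ S M hM) w)
    (G : (PBond (F.P K) 0 → Matrix (Fin 2) (Fin 2) ℂ) →ₗ[ℂ] (PBond (F.P K) 0 → Matrix (Fin 2) (Fin 2) ℂ))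
    (W Mv : (PBond (F.P K) 0 → Matrix (Fin 2) (Fin 2) ℂ) → (PBond (F.P K) 0 → Matrix (Fin 2) (Fin 2) ℂ))
    {B₀ C₄ a₃ r B_M e : ℝ}
    (hG : ∀ (f : PBond (F.P K) 0 → Matrix (Fin 2) (Fin 2) ℂ) (β : ℝ), (∀ b, w 3 b * ‖f b‖ ≤ β) →
      (∀ b, w 1 b * ‖G f b‖ ≤ B₀ * β) ∧
        ∀ (b : PBond (F.P K) 0) (ν : Fin 3), w 2 b * (F.L : ℝ) ^ (K - n) * ‖G f ⟨b.src.shift ν, b.dir⟩ - G f b‖ ≤ B₀ * β)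
    (hWq : ∀ (Y : PBond (F.P K) 0 → Matrix (Fin 2) (Fin 2) ℂ) (r' : ℝ), r' < a₃ → (∀ b, w 1 b * ‖Y b‖ ≤ r') →
      (∀ (b : PBond (F.P K) 0) (ν : Fin 3), w 2 b * (F.L : ℝ) ^ (K - n) * ‖Y ⟨b.src.shift ν, b.dir⟩ - Y b‖ ≤ r') →
        ∀ b, w 3 b * ‖W Y b‖ ≤ C₄ * r' ^ 2)
    (hMl : ∀ (f : PBond (F.P K) 0 → Matrix (Fin 2) (Fin 2) ℂ) (β : ℝ), (∀ b, w 3 b * ‖f b‖ ≤ β) → ∀ b, w 3 b * ‖Mv f b‖ ≤ B_M * β)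
    {A₁ 𝔄 : PBond (F.P K) 0 → Matrix (Fin 2) (Fin 2) ℂ} (hsol : A₁ + G (W (A₁ + 𝔄)) = 0) (hr : r < a₃)
    (h1 : ∀ b, w 1 b * ‖(A₁ + 𝔄) b‖ ≤ r)
    (h2 : ∀ (b : PBond (F.P K) 0) (ν : Fin 3), w 2 b * (F.L : ℝ) ^ (K - n) * ‖(A₁ + 𝔄) ⟨b.src.shift ν, b.dir⟩ - (A₁ + 𝔄) b‖ ≤ r)
    (hEL : ∀ (z : B7Prop1Explicit.Site (F.P K).d) (μ : Fin (F.P K).d),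
      BondTouches (pullDom (fun j => if K - n ≤ j then ({x} : Set (Site (F.P K) 0)) else (∅ : Set (Site (F.P K) 0))) (K - n)) z μ →
      pdiv (((F.L : ℝ)⁻¹) ^ (K - n)) (1 : B7Prop1Explicit.Site (F.P K).d → Fin (F.P K).d → (Matrix (Fin 2) (Fin 2) ℂ)ˣ)
          (plaqCovDeriv (((F.L : ℝ)⁻¹) ^ (K - n)) (1 : B7Prop1Explicit.Site (F.P K).d → Fin (F.P K).d → (Matrix (Fin 2) (Fin 2) ℂ)ˣ)
            (pull A₁ 0)) μ z =
        -(W (A₁ + 𝔄) ⟨transl 0 z, μ⟩) + Mv (W (A₁ + 𝔄)) ⟨transl 0 z, μ⟩)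
    (he₁ : B₀ * (C₄ * r ^ 2) ≤ e) (he₂ : (1 + B_M) * (C₄ * r ^ 2) ≤ e) :
    (∀ (z : B7Prop1Explicit.Site (F.P K).d) (τ : Fin (F.P K).d),
      SideTouches (pullDom (fun j => if K - n ≤ j then ({x} : Set (Site (F.P K) 0)) else (∅ : Set (Site (F.P K) 0))) (K - n)) z τ →
      ‖A₁ ⟨transl 0 z, τ⟩‖ ≤ e) ∧
    (∀ (z : B7Prop1Explicit.Site (F.P K).d) (κ τ : Fin (F.P K).d),
      SideTouches (pullDom (fun j => if K - n ≤ j then ({x} : Set (Site (F.P K) 0)) else (∅ : Set (Site (F.P K) 0))) (K - n)) z τ →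
      ‖(((F.L : ℝ)⁻¹) ^ (K - n))⁻¹ • (A₁ ⟨(transl 0 z).shift κ, τ⟩ - A₁ ⟨transl 0 z, τ⟩)‖ ≤ e) ∧
    (∀ (z : B7Prop1Explicit.Site (F.P K).d) (μ : Fin (F.P K).d),
      BondTouches (pullDom (fun j => if K - n ≤ j then ({x} : Set (Site (F.P K) 0)) else (∅ : Set (Site (F.P K) 0))) (K - n)) z μ →
      ‖pdiv (((F.L : ℝ)⁻¹) ^ (K - n)) (1 : B7Prop1Explicit.Site (F.P K).d → Fin (F.P K).d → (Matrix (Fin 2) (Fin 2) ℂ)ˣ)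
          (plaqCovDeriv (((F.L : ℝ)⁻¹) ^ (K - n)) (1 : B7Prop1Explicit.Site (F.P K).d → Fin (F.P K).d → (Matrix (Fin 2) (Fin 2) ℂ)ˣ)
            (pull A₁ 0)) μ z‖ ≤ e) := by
  have hkm : K - n ≤ (F.P K).m + (F.P K).K := FlatMinimizerH.le_T3 F n K
  have hL0 : (0 : ℝ) < (F.L : ℝ) := by exact_mod_cast lt_trans zero_lt_one F.hL.2
  have hη : ((((F.L : ℝ)⁻¹) ^ (K - n))⁻¹ : ℝ) = (F.L : ℝ) ^ (K - n) := by rw [inv_pow, inv_inv]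
  have hρ1' : (1 : ℝ) ≤ (ρ : ℝ) := by exact_mod_cast hρ1
  -- the weights are `1` at every bond whose source is one block from `Bᵏ(x)`
  have hw1 : ∀ {b : PBond (F.P K) 0}, distSite (Mk (F.P K) 0) b.src x ≤ 1 → ∀ m, w m b = 1 := by
    intro b hb m
    have hblk := distSite_iterBlockOf_le_one_of_le_one hkm hb
    exact levWeight_eq_one_of_inOm_top rfl hw (inOm_top_of_dist hnK x ρ S M hM hblk hρ1') m
  -- the two F4 letters at every bond
  obtain ⟨hs, hg⟩ := supGrad_solution158_dom_le F n K w G W hG hWq hsol hr h1 h2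
  refine ⟨fun z τ hz => ?_, fun z κ τ hz => ?_, fun z μ hz => ?_⟩
  · -- sup letter
    have hd := dist_le_one_of_sideTouches x (K - n) hz
    have h := hs ⟨transl 0 z, τ⟩
    rw [hw1 (b := ⟨transl 0 z, τ⟩) hd 1, one_mul] at h
    exact h.trans he₁
  · -- gradient letter
    have hd := dist_le_one_of_sideTouches x (K - n) hz
    have h := hg ⟨transl 0 z, τ⟩ κ
    rw [hw1 (b := ⟨transl 0 z, τ⟩) hd 2, one_mul] at h
    rw [norm_smul, hη, Real.norm_of_nonneg (pow_nonneg hL0.le _)]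
    exact h.trans he₁
  · -- second-order letter, from the `Δ`-row identity on the layer
    have hd := dist_le_one_of_bondTouches x (K - n) hz
    have hw3 : ∀ b, 0 ≤ w 3 b := fun b => by rw [hw 3 b]; positivity
    have h := second_solution158_dom_le F n K w hw3 W hWq hr h1 h2
      (fun A (p : B7Prop1Explicit.Site (F.P K).d × Fin (F.P K).d) =>
        pdiv (((F.L : ℝ)⁻¹) ^ (K - n)) (1 : B7Prop1Explicit.Site (F.P K).d → Fin (F.P K).d → (Matrix (Fin 2) (Fin 2) ℂ)ˣ)
          (plaqCovDeriv (((F.L : ℝ)⁻¹) ^ (K - n)) (1 : B7Prop1Explicit.Site (F.P K).d → Fin (F.P K).d → (Matrix (Fin 2) (Fin 2) ℂ)ˣ)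
            (pull A 0)) p.2 p.1)
      (fun p => (⟨transl 0 p.1, p.2⟩ : PBond (F.P K) 0))
      {p | BondTouches (pullDom (fun j => if K - n ≤ j then ({x} : Set (Site (F.P K) 0)) else (∅ : Set (Site (F.P K) 0))) (K - n)) p.1 p.2}
      Mv hMl (fun p hp => hEL p.1 p.2 hp) (z, μ) hz
    rw [hw1 (b := ⟨transl 0 z, μ⟩) hd 3, one_mul] at h
    exact h.trans he₂

/-- **(v1.1, append-only) THE SAME ROW WITH THE MULTIPLIER LETTER ASKED ONLY ON THE LAYER** (★w3-19200 g3's ASK 2026-08-28 02:53Z: the junction's `B_M` is print's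
top-layer letter, p. 298): `hMl` is required only at the `BondTouches` bonds of the one-point top family at `x` (where the weights are `1`), unweighted; all else as in
`row165_of_smallSolution`.  **THE (165)-`A₁` ROW OF `HalvingAssembly.H_of_package` / `HalvingAssemblyInterior.H_of_packageInt`, VERBATIM, FROM F4 + (98) + THE `Δ`-ROW.**
At the cube sequence `D := cubeSeqMT3 F n K x ρ S M` (centre `x`, inner radius `ρ ≥ 1`) with its level weights `w` (`IsLevWeight`), let `G̃` carry P2's two
weighted sup letters (constant `B₀`), `W` Proposition 4's (98) on the weighted (115)-ball of radius `a₃` (constant `C₄`), and let `A₁` solve (158)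
`A₁ + G̃(W(A₁ + 𝔄)) = 0` with `‖A₁ + 𝔄‖₍₁₅₂₎ ≤ r < a₃` (print: `𝔄 = HB`, `r = 36dL²B₁Mε₀`); let the flat second-order letter of `A₁` on the `BondTouches`
layer of the one-point top family at `x` satisfy the `Δ`-row identity `∂^{η*}∂^ηA₁ = −W(A₁ + 𝔄) + M(W(A₁ + 𝔄))` (§1; `M = QᵀK⁻¹QG` with weighted sup letter
`B_M`).  Then for every `e ≥ B₀C₄r²`, `e ≥ (1 + B_M)C₄r²` the three conjuncts of the package's (165)-`A₁` clause hold with bound `e` (the consumer takes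
`e = K₁ε₀²`): the layer lies in the top cube `□_k ∋ Bᵏ(x)` (one block thick), where every weight is `1`.
[cite: Balaban1985Variational, (165) p.304, (158) p.302, (152) p.301, (133) p.298; Balaban1985RegularSpaces, (1.140) p.100] -/
theorem row165_of_smallSolution_layer (hnK : n < K) (x : Site (F.P K) 0) (ρ S M : ℕ) (hM : 1 ≤ M) (hρ1 : 1 ≤ ρ)
    {w : ℕ → PBond (F.P K) 0 → ℝ} (hw : IsLevWeight F n K (cubeSeqMT3 F n K x ρ S M hM) w)
    (G : (PBond (F.P K) 0 → Matrix (Fin 2) (Fin 2) ℂ) →ₗ[ℂ] (PBond (F.P K) 0 → Matrix (Fin 2) (Fin 2) ℂ))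
    (W Mv : (PBond (F.P K) 0 → Matrix (Fin 2) (Fin 2) ℂ) → (PBond (F.P K) 0 → Matrix (Fin 2) (Fin 2) ℂ))
    {B₀ C₄ a₃ r B_M e : ℝ}
    (hG : ∀ (f : PBond (F.P K) 0 → Matrix (Fin 2) (Fin 2) ℂ) (β : ℝ), (∀ b, w 3 b * ‖f b‖ ≤ β) →
      (∀ b, w 1 b * ‖G f b‖ ≤ B₀ * β) ∧
        ∀ (b : PBond (F.P K) 0) (ν : Fin 3), w 2 b * (F.L : ℝ) ^ (K - n) * ‖G f ⟨b.src.shift ν, b.dir⟩ - G f b‖ ≤ B₀ * β)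
    (hWq : ∀ (Y : PBond (F.P K) 0 → Matrix (Fin 2) (Fin 2) ℂ) (r' : ℝ), r' < a₃ → (∀ b, w 1 b * ‖Y b‖ ≤ r') →
      (∀ (b : PBond (F.P K) 0) (ν : Fin 3), w 2 b * (F.L : ℝ) ^ (K - n) * ‖Y ⟨b.src.shift ν, b.dir⟩ - Y b‖ ≤ r') →
        ∀ b, w 3 b * ‖W Y b‖ ≤ C₄ * r' ^ 2)
    (hMl : ∀ (f : PBond (F.P K) 0 → Matrix (Fin 2) (Fin 2) ℂ) (β : ℝ), (∀ b, w 3 b * ‖f b‖ ≤ β) →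
      ∀ (z : B7Prop1Explicit.Site (F.P K).d) (μ : Fin (F.P K).d),
        BondTouches (pullDom (fun j => if K - n ≤ j then ({x} : Set (Site (F.P K) 0)) else (∅ : Set (Site (F.P K) 0))) (K - n)) z μ →
        ‖Mv f ⟨transl 0 z, μ⟩‖ ≤ B_M * β)
    {A₁ 𝔄 : PBond (F.P K) 0 → Matrix (Fin 2) (Fin 2) ℂ} (hsol : A₁ + G (W (A₁ + 𝔄)) = 0) (hr : r < a₃)
    (h1 : ∀ b, w 1 b * ‖(A₁ + 𝔄) b‖ ≤ r)
    (h2 : ∀ (b : PBond (F.P K) 0) (ν : Fin 3), w 2 b * (F.L : ℝ) ^ (K - n) * ‖(A₁ + 𝔄) ⟨b.src.shift ν, b.dir⟩ - (A₁ + 𝔄) b‖ ≤ r)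
    (hEL : ∀ (z : B7Prop1Explicit.Site (F.P K).d) (μ : Fin (F.P K).d),
      BondTouches (pullDom (fun j => if K - n ≤ j then ({x} : Set (Site (F.P K) 0)) else (∅ : Set (Site (F.P K) 0))) (K - n)) z μ →
      pdiv (((F.L : ℝ)⁻¹) ^ (K - n)) (1 : B7Prop1Explicit.Site (F.P K).d → Fin (F.P K).d → (Matrix (Fin 2) (Fin 2) ℂ)ˣ)
          (plaqCovDeriv (((F.L : ℝ)⁻¹) ^ (K - n)) (1 : B7Prop1Explicit.Site (F.P K).d → Fin (F.P K).d → (Matrix (Fin 2) (Fin 2) ℂ)ˣ)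
            (pull A₁ 0)) μ z =
        -(W (A₁ + 𝔄) ⟨transl 0 z, μ⟩) + Mv (W (A₁ + 𝔄)) ⟨transl 0 z, μ⟩)
    (he₁ : B₀ * (C₄ * r ^ 2) ≤ e) (he₂ : (1 + B_M) * (C₄ * r ^ 2) ≤ e) :
    (∀ (z : B7Prop1Explicit.Site (F.P K).d) (τ : Fin (F.P K).d),
      SideTouches (pullDom (fun j => if K - n ≤ j then ({x} : Set (Site (F.P K) 0)) else (∅ : Set (Site (F.P K) 0))) (K - n)) z τ →
      ‖A₁ ⟨transl 0 z, τ⟩‖ ≤ e) ∧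
    (∀ (z : B7Prop1Explicit.Site (F.P K).d) (κ τ : Fin (F.P K).d),
      SideTouches (pullDom (fun j => if K - n ≤ j then ({x} : Set (Site (F.P K) 0)) else (∅ : Set (Site (F.P K) 0))) (K - n)) z τ →
      ‖(((F.L : ℝ)⁻¹) ^ (K - n))⁻¹ • (A₁ ⟨(transl 0 z).shift κ, τ⟩ - A₁ ⟨transl 0 z, τ⟩)‖ ≤ e) ∧
    (∀ (z : B7Prop1Explicit.Site (F.P K).d) (μ : Fin (F.P K).d),
      BondTouches (pullDom (fun j => if K - n ≤ j then ({x} : Set (Site (F.P K) 0)) else (∅ : Set (Site (F.P K) 0))) (K - n)) z μ →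
      ‖pdiv (((F.L : ℝ)⁻¹) ^ (K - n)) (1 : B7Prop1Explicit.Site (F.P K).d → Fin (F.P K).d → (Matrix (Fin 2) (Fin 2) ℂ)ˣ)
          (plaqCovDeriv (((F.L : ℝ)⁻¹) ^ (K - n)) (1 : B7Prop1Explicit.Site (F.P K).d → Fin (F.P K).d → (Matrix (Fin 2) (Fin 2) ℂ)ˣ)
            (pull A₁ 0)) μ z‖ ≤ e) := by
  have hkm : K - n ≤ (F.P K).m + (F.P K).K := FlatMinimizerH.le_T3 F n K
  have hL0 : (0 : ℝ) < (F.L : ℝ) := by exact_mod_cast lt_trans zero_lt_one F.hL.2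
  have hη : ((((F.L : ℝ)⁻¹) ^ (K - n))⁻¹ : ℝ) = (F.L : ℝ) ^ (K - n) := by rw [inv_pow, inv_inv]
  have hρ1' : (1 : ℝ) ≤ (ρ : ℝ) := by exact_mod_cast hρ1
  -- the weights are `1` at every bond whose source is one block from `Bᵏ(x)`
  have hw1 : ∀ {b : PBond (F.P K) 0}, distSite (Mk (F.P K) 0) b.src x ≤ 1 → ∀ m, w m b = 1 := by
    intro b hb m
    have hblk := distSite_iterBlockOf_le_one_of_le_one hkm hb
    exact levWeight_eq_one_of_inOm_top rfl hw (inOm_top_of_dist hnK x ρ S M hM hblk hρ1') m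
  -- the two F4 letters at every bond
  obtain ⟨hs, hg⟩ := supGrad_solution158_dom_le F n K w G W hG hWq hsol hr h1 h2
  refine ⟨fun z τ hz => ?_, fun z κ τ hz => ?_, fun z μ hz => ?_⟩
  · -- sup letter
    have hd := dist_le_one_of_sideTouches x (K - n) hz
    have h := hs ⟨transl 0 z, τ⟩
    rw [hw1 (b := ⟨transl 0 z, τ⟩) hd 1, one_mul] at h
    exact h.trans he₁
  · -- gradient letter
    have hd := dist_le_one_of_sideTouches x (K - n) hz
    have h := hg ⟨transl 0 z, τ⟩ κ
    rw [hw1 (b := ⟨transl 0 z, τ⟩) hd 2, one_mul] at h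
    rw [norm_smul, hη, Real.norm_of_nonneg (pow_nonneg hL0.le _)]
    exact h.trans he₁
  · -- second-order letter, from the `Δ`-row identity on the layer, the multiplier letter read on the layer only
    have hd := dist_le_one_of_bondTouches x (K - n) hz
    have hw3 : w 3 ⟨transl 0 z, μ⟩ = 1 := hw1 (b := ⟨transl 0 z, μ⟩) hd 3
    have hWb : ∀ b, w 3 b * ‖W (A₁ + 𝔄) b‖ ≤ C₄ * r ^ 2 := hWq (A₁ + 𝔄) r hr h1 h2
    have hWz : ‖W (A₁ + 𝔄) ⟨transl 0 z, μ⟩‖ ≤ C₄ * r ^ 2 := by have h := hWb ⟨transl 0 z, μ⟩; rwa [hw3, one_mul] at h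
    have hMz : ‖Mv (W (A₁ + 𝔄)) ⟨transl 0 z, μ⟩‖ ≤ B_M * (C₄ * r ^ 2) := hMl _ _ hWb z μ hz
    rw [hEL z μ hz]
    calc ‖-(W (A₁ + 𝔄) ⟨transl 0 z, μ⟩) + Mv (W (A₁ + 𝔄)) ⟨transl 0 z, μ⟩‖
        ≤ ‖W (A₁ + 𝔄) ⟨transl 0 z, μ⟩‖ + ‖Mv (W (A₁ + 𝔄)) ⟨transl 0 z, μ⟩‖ := (norm_add_le _ _).trans (by rw [norm_neg])
      _ ≤ C₄ * r ^ 2 + B_M * (C₄ * r ^ 2) := add_le_add hWz hMz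
      _ = (1 + B_M) * (C₄ * r ^ 2) := by ring
      _ ≤ e := he₂

end Package

end Summit.QuantumFields.YangMills.Theorems.HalvingA1Row165

end
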